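import Literature.AlgebraicGeometry.Frobenioids.GeometricDivisorDataProjectiveLine
import HarnessLib

/-!
# Frobenioids I, Theorem 6.2 (iii): the zero-or-pole hypothesis HOLDS at THE geometric datum of `ℙ¹_k`

Mochizuki, *The geometry of Frobenioids I: the general theory*, Kyushu J. Math. **62** (2008) 293–400, Thm. 6.2
(iii), kurims p. 111 [cite: MochizukiFrdI2008, Thm. 6.2 (iii) p.111]: "If, moreover, for every finite extension
`L ⊆ K̃` of `K`, and every `D ∈ D_L`, it holds that `D` lies in the support of the image in `Φ(L)^gp` of an
element of `B(L)`, then `C` is of rationally standard type."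

PROOF-ONLY companion (cell abc-iut, block F, seat abc-iut-f-041) of `GeometricDivisorDataProjectiveLine.lean`
(p432678: `ProjLine.data k`, THE data of Ex. 6.1 for `V = ℙ¹_k`, `K̃ = K = k(X)`, `D_K` = all closed points).
The typed Thm. 6.2 (iii) (`Thm62iii`, abc-iut-L1-t3; at THE constructions `Thm62iii_rsParams_iff`,
abc-iut-L6-t10) carries the quoted hypothesis as an antecedent
`∀ X P, ∃ f : Γ.B X, (toAdd (Γ.div X f)) P ≠ 0`.  At the only inhabitant of the interface previously in the
tree (`GeometricDivisorData.trivial`, `B = 1`) that antecedent is FALSE, so the clause was vacuous there; here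
it is PROVED at the genuine datum `ProjLine.data k`: every closed point of `ℙ¹_k` is a zero or a pole of a
rational function — a finite place `v = (p)` (`p` a generator of the height-one prime `v` of the principal
ideal domain `k[X]`) is a simple zero of `p` (`ProjLine.exists_ord_some_eq_one`), and `∞` is a simple pole of
`X` (`ProjLine.ord_X_infty`):

* `ProjLine.data_support_hypothesis` — the antecedent of the rationally-standard clause of `Thm62iii` at
  `Γ = ProjLine.data k`.

No definitions; nothing here bears on [IUTchIII] Cor. 3.12 or asserts anything about abc.
-/

noncomputable section

namespace Literature.AlgebraicGeometry.Frobenioids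

open CategoryTheory IsDedekindDomain Polynomial

namespace ProjLine

variable (k : Type) [Field k]

/-- Every element of `K = k(X)` lies in every intermediate field of `K/K` (each of them is all of `K`:
`K̃ = K`, so every `Spec L ∈ Ob(D)` is `Spec K`). [cite: MochizukiFrdI2008, Ex. 6.1 p.109] -/
theorem mem_intermediateField (M : IntermediateField (RatFunc k) (RatFunc k)) (x : RatFunc k) : x ∈ M := by
  simpa using M.algebraMap_mem x

/-- The unit of `L ∈ Ob(D)` given by a nonzero rational function maps to it under `toUnits` (plumbing). [folklore] -/
private theorem toUnits_mk0 (X : FinSubextCat (RatFunc k) (RatFunc k)) (x : RatFunc k) (hx : x ≠ 0) :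
    toUnits k X (Units.mk0 ⟨x, mem_intermediateField k X.L x⟩ (fun h => hx (congrArg Subtype.val h))) =
      Units.mk0 x hx :=
  Units.ext rfl

/-- A finite place `v = (p)` of `ℙ¹_k` — `p` a generator of the height-one prime `v` of the principal ideal
domain `k[X]` — is a simple zero of `p`: `ord_v(p) = 1`. [cite: MochizukiFrdI2008, Ex. 6.1 p.109] -/
theorem exists_ord_some_eq_one (v : HeightOneSpectrum k[X]) :
    ∃ (p : k[X]) (hp : algebraMap k[X] (RatFunc k) p ≠ 0),
      ord (Units.mk0 (algebraMap k[X] (RatFunc k) p) hp) (some v) = 1 := by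
  obtain ⟨p, hp⟩ := (IsPrincipalIdealRing.principal v.asIdeal).principal
  have hp0 : p ≠ 0 := by
    rintro rfl
    exact v.ne_bot (by rw [hp, Submodule.span_singleton_eq_bot.mpr rfl])
  have hpK : algebraMap k[X] (RatFunc k) p ≠ 0 :=
    (map_ne_zero_iff _ (IsFractionRing.injective k[X] (RatFunc k))).mpr hp0
  refine ⟨p, hpK, ?_⟩
  rw [ord_some, Units.val_mk0, HeightOneSpectrum.valuation_of_algebraMap,
    HeightOneSpectrum.intValuation_singleton _ hp0 (by rw [hp])]
  simp

/-- **The hypothesis of Thm. 6.2 (iii)'s rationally-standard clause HOLDS at `ℙ¹_k`**: "for every finite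
extension `L ⊆ K̃` of `K`, and every `D ∈ D_L`, `D` lies in the support of the image in `Φ(L)^gp` of an
element of `B(L)`" — at THE datum `ProjLine.data k` (`B(L) = L^×`, `div` = the divisor map of `ℙ¹_k`) every
closed point is a zero or a pole of a rational function: a finite place `(p)` is a zero of `p`, `∞` is a pole
of `X`. [cite: MochizukiFrdI2008, Thm. 6.2 (iii) p.111] -/
theorem data_support_hypothesis (X : FinSubextCat (RatFunc k) (RatFunc k)) (P : (data k).primeDiv X) :
    ∃ f : (data k).B X, (Multiplicative.toAdd ((data k).div X f)) P ≠ 0 := by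
  cases P with
  | none =>
    refine ⟨⟨Units.mk0 ⟨RatFunc.X, mem_intermediateField k X.L _⟩
      (fun h => RatFunc.X_ne_zero (congrArg Subtype.val h)), trivial⟩, ?_⟩
    change ord (toUnits k X (Units.mk0 ⟨RatFunc.X, mem_intermediateField k X.L _⟩
      (fun h => RatFunc.X_ne_zero (congrArg Subtype.val h)))) none ≠ 0
    rw [toUnits_mk0, ord_X_infty]
    decide
  | some v =>
    obtain ⟨p, hp, hord⟩ := exists_ord_some_eq_one k v
    refine ⟨⟨Units.mk0 ⟨_, mem_intermediateField k X.L _⟩ (fun h => hp (congrArg Subtype.val h)),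
      trivial⟩, ?_⟩
    change ord (toUnits k X (Units.mk0 ⟨_, mem_intermediateField k X.L _⟩
      (fun h => hp (congrArg Subtype.val h)))) (some v) ≠ 0
    rw [toUnits_mk0, hord]
    exact one_ne_zero

end ProjLine

end Literature.AlgebraicGeometry.Frobenioids

end
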